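import Literature.AlgebraicGeometry.Motives.HodgeStructureLefschetzGroupCenterFinite
import HarnessLib

/-!
# FIRST KIND: THE CENTRE OF `S(A)(ℚ)` IS `μ₂^t` CANONICALLY — A CENTRAL ELEMENT ACTS ON EACH SIMPLE FACTOR (CANONICAL BLOCK)
# BY A SIGN, AND `γ ↦ (ε_S(γ))_S` IS A GROUP ISOMORPHISM `Z(S(H)(ℚ)) ≅ {±1}^{blocks}` (Milne 1999 §1 p. 645 `S₀(A) = U_{C₀}`,
# `C₀ = K₁ × ⋯ × K_t`; §2 Summary p. 652; Moonen–Zarhin 1998 §1 Lemma (1))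

[topic AlgebraicGeometry/Motives]

Layer `Literature/AlgebraicGeometry/Motives`, lane `lit-hodgefound` (Track 2 foundations library; prover seat
`lit-hodgefound-p02`, generation 55, self-proposed row g55-#1). THEOREMS ONLY: no definition, no named fact (net debt `0`),
no instance, no notation.  Sequel of g54-#8 (`Motives/HodgeStructureLefschetzGroupCenterFinite`: `Z(S(H)(ℚ)) ≅ S₀(ℚ) =
{z ∈ C₀ | z† z = 1}` as a SET, and `#Z(S(H)(ℚ)) = 2^t` for `†` of the first kind), which counted the centre through a CHOSEN
ring chart `ζ : C₀ ≃+* Π_k K_k`.  Milne (p. 645): `C₀(A)` «is a product of fields […]. Every Rosati involution `†` preserves each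
factor of `C₀(A)`», `S₀(A)(R) = {γ ∈ C₀(A) ⊗_ℚ R | γ†γ = 1}`; so when `†` is the identity on `C₀ = K₁ × ⋯ × K_t` (types I–III)
`S₀(ℚ) = {(x_k) | x_k² = 1} = {±1}^t`, the `k`-th coordinate being THE SCALAR BY WHICH `γ` ACTS ON THE `k`-TH SIMPLE FACTOR.  Here
this is made intrinsic, for a polarized `ℚ`-Hodge structure `(H, ψ)` with `E_φ = End_{ℚ-HS}(V)` and `†` trivial on `Z(E_φ)`:
(i) a central `γ ∈ S(H)(ℚ)` acts on every CANONICAL BLOCK `S` of `H` (minimal non-zero `E_φ`-stable sub-Hodge structure =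
isotypic component = simple factor of `E_φ`; also on every irreducible sub-Hodge structure) as a SIGN `ε_S(γ) = ±1`:
`γ v = ε_S(γ) v` for `v ∈ S` — `↑γ = z ∈ Z(E_φ)` with `z² = 1` (g54-#5), and the component of `z` in the FIELD `Z(E_φ(S))` is
`±1`;
(ii) `γ ↦ (ε_S(γ))_S` is a GROUP ISOMORPHISM `Z(S(H)(ℚ)) ≃* ({canonical blocks} → ℤˣ)`, characterised by the formula in (i)
and UNIQUE with it: injective because `V = ⊕_S S`, surjective because every sign vector `(ε_S)` is the chart of a `†`-fixed
central unit `z` with `z† z = z² = 1`, i.e. of a central `γ` (g54-#8 §1) — «`S₀(A) ≅ μ₂^t`» with its action on `V`;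
(iii) consequences: a central `γ` is determined by its signs; `γ = 1` iff all signs are `+1`; every sign vector is realised by
exactly one central `γ`; and the count `#Z(S(H)(ℚ)) = 2^t` of g54-#8 is recovered from the isomorphism.

## The sources, verbatim

* J. S. Milne, *Lefschetz classes on abelian varieties*, Duke Math. J. 96 (1999) 639–675 [Milne1999LefschetzClasses] (held
  `paper:doi-10-1215-s0012-7094-99-09620-5`, folios 6–7, 14): p. 644 L16–L18 "we define `S(A)` to be the algebraic subgroup of
  `GL(V(A))` such that, for all commutative `k`-algebras `R`, `S(A)(R) = {γ ∈ C(A) ⊗_k R | γ†γ = 1}`"; p. 645 L1–L6 "let `C₀(A)`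
  be the centre of the `ℚ`-algebra `End⁰(A)` — it is a product of fields, each of which is either a CM-field or `ℚ`. Every Rosati
  involution `†` preserves each factor of `C₀(A)` and acts on it as complex conjugation. Define `S₀(A)` to be the algebraic group
  over `ℚ` such that, for all commutative `ℚ`-algebras `R`, `S₀(A)(R) = {γ ∈ C₀(A) ⊗_ℚ R | γ†γ = 1}`."; Prop. 1.7 "an
  isomorphism of algebraic groups `S₀(A)_{/ℚ_ℓ} → S_ℓ(A)`" onto the centre part; §2 Summary p. 652 (I–III: semisimple).
* B. J. J. Moonen, Yu. G. Zarhin, *Weil classes on abelian varieties*, J. reine angew. Math. 496 (1998) 83–92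
  [MoonenZarhin1998WeilClasses] (held `paper:arxiv-alg-geom_9612017`, chunk p0002 L121–L127): «Lemma. (1) The center of
  `G_div(X)` is the group `U_{K_B}` given by `U_{K_B}(R) = {a ∈ (K_B ⊗_ℚ R)^* ∣ a a† = 1}`. […] in all other cases it is finite.»
* H. Lange, *Abelian Varieties over the Complex Numbers* (2023) [Lange2023AbelianVarietiesComplex], §2.4.4 Cor. 2.4.26 (the
  simple factors `End_ℚ(X) ≅ ⊕ M_{n_i}(End_ℚ(X_i))`), §2.6.2 Lemma 2.6.4 (first kind on the centre).

Nearest tree results, BY NAME: g54-#8 `Polarization.bijOn_coe_center_lefschetzGroup` (the centre as the SET `S₀(ℚ)`),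
`Polarization.natCard_center_lefschetzGroup_eq_two_pow` (the COUNT `2^t` through a chosen chart), g54-#5
`Polarization.coe_mul_coe_eq_one_of_mem_center_lefschetzGroup` (`γ² = 1`), `Polarization.mem_center_lefschetzGroup_iff_of_isTotallyReal`
(field centre: `Z = {±1}` globally); the labelled decomposition `exists_algEquiv_pi_endAlg_iSup'_fiber`, `exists_ringEquiv_subringCenter_pi`,
`minimal_stable_iSup'_fiber`, `existsUnique_iSup'_fiber_eq_of_minimal_stable`, `existsUnique_minimal_stable_le`.  Here: the
block-wise SIGNS, the canonical GROUP ISOMORPHISM with its formula and uniqueness.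

## Dictionary and what is proved (namespace `Literature.AlgebraicGeometry.Motives.HodgeStructure`)

`S(H)(ℚ) = ψ.lefschetzGroup ≤ GL(V)`, `Z(E_φ) = Subalgebra.center ℚ H.endAlg`, `†` = `ψ.adjoint`, "first kind" = `hfix :
∀ z ∈ Z(E_φ), z† = z`; a canonical block is an `S : SubHodgeStructure H` which is `E_φ`-stable, non-zero and minimal such (the
tree's predicate, verbatim); in a labelled irreducible decomposition `V = ⊕ᵢ Tᵢ` (`c i` = the isotypy class of `Tᵢ`) the blocks
are `W_k = ⨆_{c i = k} Tᵢ`.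

* §1 SIGNS: **`Polarization.exists_forall_apply_eq_smul_iSup'_fiber_of_mem_center_lefschetzGroup`** (labelled: `γ|_{W_k} = ±1`),
  **`Polarization.exists_forall_apply_eq_smul_of_mem_center_lefschetzGroup`** (intrinsic: `γ|_S = ±1` on every canonical block `S`),
  **`Polarization.exists_forall_apply_eq_smul_of_mem_center_lefschetzGroup_of_isIrreducible`** (`γ|_U = ±1` on every
  irreducible sub-Hodge structure `U`).
* §2 THE ISOMORPHISM: **`Polarization.exists_mulEquiv_center_lefschetzGroup_pi_units`** (`Z(S(H)(ℚ)) ≃* ({blocks} → ℤˣ)` with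
  `γ v = (e γ S) • v` on `S`), **`Polarization.mulEquiv_center_lefschetzGroup_pi_units_unique`** (any two maps with the formula
  agree), **`Polarization.existsUnique_mem_center_lefschetzGroup_forall_apply_eq_smul`** (every sign vector is realised by exactly
  one central `γ`), **`Polarization.eq_of_forall_exists_forall_apply_eq_smul`** (central `γ, γ'` with the same signs are equal),
  **`Polarization.eq_one_of_forall_apply_eq_self`** (all signs `+1` iff `γ = 1`).
-/

noncomputable section

namespace Literature.AlgebraicGeometry.Motives

namespace HodgeStructure

universe u

variable {V : Type u} [AddCommGroup V] [Module ℚ V] [Module.Finite ℚ V] {n : ℤ} {H : HodgeStructure V n}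

/-! ## §0 Elementary lemmas -/

omit [Module.Finite ℚ V] in
/-- In a commutative ring which is a field, `y² = 1 ⟹ y = ±1`, written as `y = ε` for a unit `ε ∈ ℤˣ`. [folklore] -/
private theorem exists_units_eq_intCast_of_mul_self_eq_one₅₅ {R : Type*} [CommRing R] (hR : IsField R) {y : R}
    (hy : y * y = 1) : ∃ ε : ℤˣ, y = ((ε : ℤ) : R) := by
  by_cases h : y - 1 = 0
  · exact ⟨1, by rw [Units.val_one, Int.cast_one]; exact sub_eq_zero.1 h⟩
  · obtain ⟨w, hw⟩ := hR.mul_inv_cancel h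
    refine ⟨-1, ?_⟩
    rw [Units.val_neg, Units.val_one, Int.cast_neg, Int.cast_one]
    refine eq_neg_of_add_eq_zero_left ?_
    calc y + 1 = (y - 1) * w * (y + 1) := by rw [hw, one_mul]
      _ = w * ((y - 1) * (y + 1)) := by ring
      _ = 0 := by rw [show (y - 1) * (y + 1) = 0 by linear_combination hy, mul_zero]

omit [Module.Finite ℚ V] in
/-- In a `ℚ`-vector space a non-zero vector distinguishes the signs: `ε • v = ε' • v`, `v ≠ 0` ⟹ `ε = ε'` (`ε, ε' ∈ ℤˣ`).
[folklore] -/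
private theorem units_eq_of_smul_eq_smul₅₅ {v : V} (hv : v ≠ 0) {ε ε' : ℤˣ} (h : (ε : ℤ) • v = (ε' : ℤ) • v) :
    ε = ε' := by
  have key : ∀ w : V, w = -w → w = 0 := fun w hw => by
    have h2 : (2 : ℚ) • w = 0 := by rw [two_smul]; nth_rewrite 2 [hw]; exact add_neg_cancel w
    exact (smul_eq_zero.1 h2).resolve_left two_ne_zero
  rcases Int.units_eq_one_or ε with rfl | rfl <;> rcases Int.units_eq_one_or ε' with rfl | rfl
  · rfl
  · rw [Units.val_one, one_zsmul, Units.val_neg, Units.val_one, neg_one_zsmul] at h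
    exact absurd (key v h) hv
  · rw [Units.val_one, one_zsmul, Units.val_neg, Units.val_one, neg_one_zsmul] at h
    exact absurd (key v h.symm) hv
  · rfl

omit [Module.Finite ℚ V] in
/-- The sign on a non-zero subspace is well defined: if a map acts on a non-zero `ℚ`-subspace `S` both as `ε` and as `ε'`
(`ε, ε' ∈ ℤˣ`), then `ε = ε'`. [folklore] -/
private theorem units_eq_of_forall_apply_eq_smul_of_ne_bot₅₅ {f : V → V} {S : Submodule ℚ V} (hS : S ≠ ⊥) {ε ε' : ℤˣ}
    (h : ∀ v ∈ S, f v = (ε : ℤ) • v) (h' : ∀ v ∈ S, f v = (ε' : ℤ) • v) : ε = ε' := by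
  obtain ⟨v, hvS, hv⟩ := (Submodule.ne_bot_iff S).1 hS
  exact units_eq_of_smul_eq_smul₅₅ hv ((h v hvS).symm.trans (h' v hvS))

omit [Module.Finite ℚ V] in
/-- An integer `m`, read in the centre `Z(E_φ(W))` of the endomorphism algebra of a sub-Hodge structure `W` and then as an
endomorphism of `W ⊆ V`, acts as `v ↦ m • v`. [folklore] -/
private theorem coe_intCast_subringCenter_apply₅₅ (W : SubHodgeStructure H) (m : ℤ) (v : V) (hv : v ∈ W.toSubmodule) :
    (((((m : Subring.center W.toHodgeStructure.endAlg) : W.toHodgeStructure.endAlg) :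
      Module.End ℚ W.toSubmodule) ⟨v, hv⟩ : W.toSubmodule) : V) = m • v := by
  rw [SubringClass.coe_intCast, SubringClass.coe_intCast, Module.End.intCast_apply, Submodule.coe_smul_of_tower]

omit [Module.Finite ℚ V] in
/-- Sign vectors in a product of rings: along `ζ : Z ≃+* Π_k R_k`, every `σ : ι → ℤˣ` is the chart of a (unique) `w ∈ Z` with
`w² = 1` (abstract carriers, instantiated below with `Z = Z(E_φ)`, `R_k = Z(E_φ(W_k))`). [folklore] -/
private theorem exists_mul_self_eq_one_forall_apply_eq₅₅ {Z : Type*} [CommRing Z] {ι : Type*} {R : ι → Type*}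
    [∀ k, CommRing (R k)] (ζ : Z ≃+* Π k, R k) (σ : ι → ℤˣ) :
    ∃ w : Z, w * w = 1 ∧ ∀ k, ζ w k = ((σ k : ℤ) : R k) := by
  refine ⟨ζ.symm fun k => ((σ k : ℤ) : R k), ζ.injective ?_, fun k => by rw [ζ.apply_symm_apply]⟩
  rw [ζ.map_mul, ζ.map_one, ζ.apply_symm_apply]
  funext k
  rw [Pi.mul_apply, Pi.one_apply, ← Int.cast_mul, ← Units.val_mul, Int.units_mul_self, Units.val_one, Int.cast_one]

/-! ## §1 A central element of `S(H)(ℚ)` acts on each canonical block by a sign -/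

section Labelled

variable {ι : Type*} [Fintype ι] [DecidableEq ι] (T : ι → SubHodgeStructure H)
  (hT : DirectSum.IsInternal fun i => (T i).toSubmodule) {κ : Finset ι} {c : ι → κ}
  (hc : ∀ i, ∃ g : Hom (T i).toHodgeStructure (T (c i)).toHodgeStructure, Function.Bijective g.toLinearMap)
  (hκ : ∀ k k' : κ, (∃ g : Hom (T k).toHodgeStructure (T k').toHodgeStructure,
    Function.Bijective g.toLinearMap) → k = k')

include hT hc hκ

set_option maxHeartbeats 400000 in
/-- **LABELLED FORM — A CENTRAL `γ ∈ S(H)(ℚ)` ACTS ON EACH BLOCK `W_k = ⨆_{c i = k} Tᵢ` AS `±1`** (`†` of the first kind): along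
`E_φ ≃ₐ Π_k E_φ(W_k)` (`exists_algEquiv_pi_endAlg_iSup'_fiber`) and `ζ : Z(E_φ) ≃+* Π_k Z(E_φ(W_k))`
(`exists_ringEquiv_subringCenter_pi`), `↑γ = z ∈ Z(E_φ)` has `z² = 1` (g54-#5), so its `k`-th coordinate is a square root of `1`
in the FIELD `Z(E_φ(W_k))` (`E_φ(W_k)` simple, `isSimpleRing_endAlg_iSup'_fiber`), i.e. `±1`, and that coordinate is how `z` acts
on `W_k`. [cite: Milne1999LefschetzClasses, §1 p. 645 L1–L6 (C₀ a product of fields, S₀) and §2 Summary p. 652]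
[cite: Lange2023AbelianVarietiesComplex, §2.4.4 Cor. 2.4.26 and §2.6.2 Lemma 2.6.4] -/
theorem Polarization.exists_forall_apply_eq_smul_iSup'_fiber_of_mem_center_lefschetzGroup (ψ : Polarization H)
    (hirr : ∀ i, (T i).toHodgeStructure.IsIrreducible)
    (hfix : ∀ z : H.endAlg, z ∈ Subalgebra.center ℚ H.endAlg → ψ.adjoint (z : Module.End ℚ V) = z)
    {γ : ψ.lefschetzGroup} (hγ : γ ∈ Subgroup.center ψ.lefschetzGroup) (k : κ) :
    ∃ ε : ℤˣ, ∀ v ∈ (SubHodgeStructure.iSup' fun x : {i // c i = k} => T x.1).toSubmodule,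
      (γ : V ≃ₗ[ℚ] V) v = (ε : ℤ) • v := by
  classical
  obtain ⟨e, he⟩ := exists_algEquiv_pi_endAlg_iSup'_fiber T hT hc hκ hirr
  obtain ⟨ζ, hζ⟩ := exists_ringEquiv_subringCenter_pi
    (fun k : κ => SubHodgeStructure.iSup' fun x : {i // c i = k} => T x.1) e
  obtain ⟨z, hzc, hzγ⟩ := (ψ.mem_center_lefschetzGroup_iff_exists_mem_center γ).1 hγ
  have hzc' : z ∈ Subring.center H.endAlg := Subring.mem_center_iff.2 (Subalgebra.mem_center_iff.1 hzc)
  -- `z² = 1` in `Z(E_φ)`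
  have hzz : (⟨z, hzc'⟩ : Subring.center H.endAlg) * ⟨z, hzc'⟩ = 1 := by
    apply Subtype.ext
    apply Subtype.ext
    show ((z * z : H.endAlg) : Module.End ℚ V) = ((1 : H.endAlg) : Module.End ℚ V)
    rw [Subalgebra.coe_mul, Subalgebra.coe_one, hzγ]
    exact ψ.coe_mul_coe_eq_one_of_mem_center_lefschetzGroup hfix hγ
  -- hence its `k`-th centre coordinate is `±1` in the field `Z(E_φ(W_k))`
  have hsq : ζ ⟨z, hzc'⟩ k * ζ ⟨z, hzc'⟩ k = 1 := by
    rw [← Pi.mul_apply, ← ζ.map_mul, hzz, ζ.map_one, Pi.one_apply]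
  obtain ⟨ε, hε⟩ := exists_units_eq_intCast_of_mul_self_eq_one₅₅
    (isField_subringCenter_endAlg_of_isSimpleRing _ (isSimpleRing_endAlg_iSup'_fiber T hT hc hκ hirr k)) hsq
  refine ⟨ε, fun v hv => ?_⟩
  -- `γ v = z v = (e z)_k v = (ζ z)_k v = ε • v`
  have h1 := he z k ⟨v, hv⟩
  rw [Submodule.coe_mk] at h1
  have h2 : e z k = ((ζ ⟨z, hzc'⟩ k : Subring.center _) : _) := (hζ ⟨z, hzc'⟩ k).symm
  rw [← LinearEquiv.coe_coe, ← hzγ, ← h1, h2, hε]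
  exact coe_intCast_subringCenter_apply₅₅ _ (ε : ℤ) v hv

end Labelled

/-- **A CENTRAL `γ ∈ S(H)(ℚ)` ACTS ON EVERY CANONICAL BLOCK BY A SIGN** (`†` of the first kind, types I–III): for every minimal
non-zero `E_φ`-stable sub-Hodge structure `S` of `H` (= simple factor of `E_φ` = isotypic component) there is `ε = ±1` with
`γ v = ε v` for all `v ∈ S` — «`S₀(A)(ℚ) = {γ ∈ C₀ | γ†γ = 1}`, `C₀ = K₁ × ⋯ × K_t`, `†` preserves each factor»: with `†` trivial
on `C₀` the `S`-coordinate of `γ` satisfies `x² = 1` in the field `K_S`. (`S` is a block `W_k` of any labelled irreducible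
decomposition, `existsUnique_iSup'_fiber_eq_of_minimal_stable`; §1 labelled form.) [cite: Milne1999LefschetzClasses, §1 p. 645 L1–L6 and §2 Summary p. 652]
[cite: MoonenZarhin1998WeilClasses, §1 Lemma (1)] [cite: Lange2023AbelianVarietiesComplex, §2.4.4 Cor. 2.4.26 and §2.6.2 Lemma 2.6.4] -/
theorem Polarization.exists_forall_apply_eq_smul_of_mem_center_lefschetzGroup (ψ : Polarization H)
    (hfix : ∀ z : H.endAlg, z ∈ Subalgebra.center ℚ H.endAlg → ψ.adjoint (z : Module.End ℚ V) = z)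
    {γ : ψ.lefschetzGroup} (hγ : γ ∈ Subgroup.center ψ.lefschetzGroup) {S : SubHodgeStructure H}
    (hS : (∀ a ∈ H.endAlg, ∀ v ∈ S.toSubmodule, a v ∈ S.toSubmodule) ∧ S.toSubmodule ≠ ⊥ ∧
      ∀ S' : SubHodgeStructure H, (∀ a ∈ H.endAlg, ∀ v ∈ S'.toSubmodule, a v ∈ S'.toSubmodule) →
        S'.toSubmodule ≤ S.toSubmodule → S'.toSubmodule = ⊥ ∨ S'.toSubmodule = S.toSubmodule) :
    ∃ ε : ℤˣ, ∀ v ∈ S.toSubmodule, (γ : V ≃ₗ[ℚ] V) v = (ε : ℤ) • v := by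
  classical
  obtain ⟨s, _, κ, c, hT, hirr, hc, hκ⟩ := exists_isInternal_isIrreducible_labelling H ⟨ψ⟩
  have hirr' : ∀ x : s, (x : SubHodgeStructure H).toHodgeStructure.IsIrreducible := fun x => hirr x x.2
  obtain ⟨k, hk, -⟩ :=
    existsUnique_iSup'_fiber_eq_of_minimal_stable (fun S : s => (S : SubHodgeStructure H)) hT hc hκ hirr' hS
  obtain ⟨ε, hε⟩ := ψ.exists_forall_apply_eq_smul_iSup'_fiber_of_mem_center_lefschetzGroup
    (fun S : s => (S : SubHodgeStructure H)) hT hc hκ hirr' hfix hγ k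
  rw [hk] at hε
  exact ⟨ε, hε⟩

/-- **A CENTRAL `γ ∈ S(H)(ℚ)` ACTS ON EVERY IRREDUCIBLE SUB-HODGE STRUCTURE BY A SIGN** (`†` of the first kind): an irreducible
`U ⊆ H` lies in exactly one canonical block (its isotypic component, `existsUnique_minimal_stable_le`), on which `γ = ±1`.
[cite: Milne1999LefschetzClasses, §1 p. 645 L1–L6 and §2 Summary p. 652] [cite: Lange2023AbelianVarietiesComplex, §2.4.4 Cor. 2.4.26 and §2.6.2 Lemma 2.6.4] -/
theorem Polarization.exists_forall_apply_eq_smul_of_mem_center_lefschetzGroup_of_isIrreducible (ψ : Polarization H)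
    (hfix : ∀ z : H.endAlg, z ∈ Subalgebra.center ℚ H.endAlg → ψ.adjoint (z : Module.End ℚ V) = z)
    {γ : ψ.lefschetzGroup} (hγ : γ ∈ Subgroup.center ψ.lefschetzGroup) {U : SubHodgeStructure H}
    (hU : U.toHodgeStructure.IsIrreducible) :
    ∃ ε : ℤˣ, ∀ v ∈ U.toSubmodule, (γ : V ≃ₗ[ℚ] V) v = (ε : ℤ) • v := by
  obtain ⟨S, ⟨hS, hUS⟩, -⟩ := existsUnique_minimal_stable_le ⟨ψ⟩ hU
  obtain ⟨ε, hε⟩ := ψ.exists_forall_apply_eq_smul_of_mem_center_lefschetzGroup hfix hγ hS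
  exact ⟨ε, fun v hv => hε v (hUS hv)⟩

/-! ## §2 `Z(S(H)(ℚ)) ≃* ({canonical blocks} → ℤˣ)`: the centre is `μ₂^t`, canonically -/

/-- **CENTRAL ELEMENTS WITH THE SAME SIGNS ARE EQUAL** (`†` of the first kind): if central `γ, γ' ∈ S(H)(ℚ)` act by the same sign
on every canonical block, then `γ = γ'` — the blocks span `V` (`V = ⊕_k W_k`). [cite: Milne1999LefschetzClasses, §1 p. 645 L1–L6 (S₀ ⊂ C₀ = Π K_k)]
[cite: Lange2023AbelianVarietiesComplex, §2.4.4 Cor. 2.4.26] -/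
theorem Polarization.eq_of_forall_exists_forall_apply_eq_smul (ψ : Polarization H) {γ γ' : ψ.lefschetzGroup}
    (h : ∀ S : SubHodgeStructure H, ((∀ a ∈ H.endAlg, ∀ v ∈ S.toSubmodule, a v ∈ S.toSubmodule) ∧ S.toSubmodule ≠ ⊥ ∧
      ∀ S' : SubHodgeStructure H, (∀ a ∈ H.endAlg, ∀ v ∈ S'.toSubmodule, a v ∈ S'.toSubmodule) →
        S'.toSubmodule ≤ S.toSubmodule → S'.toSubmodule = ⊥ ∨ S'.toSubmodule = S.toSubmodule) →
      ∃ ε : ℤˣ, (∀ v ∈ S.toSubmodule, (γ : V ≃ₗ[ℚ] V) v = (ε : ℤ) • v) ∧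
        ∀ v ∈ S.toSubmodule, (γ' : V ≃ₗ[ℚ] V) v = (ε : ℤ) • v) :
    γ = γ' := by
  classical
  obtain ⟨s, _, κ, c, hT, hirr, hc, hκ⟩ := exists_isInternal_isIrreducible_labelling H ⟨ψ⟩
  have hirr' : ∀ x : s, (x : SubHodgeStructure H).toHodgeStructure.IsIrreducible := fun x => hirr x x.2
  apply Subtype.ext
  apply LinearEquiv.toLinearMap_injective
  apply LinearMap.ext
  intro v
  have hv : v ∈ ⨆ k : κ, (SubHodgeStructure.iSup' fun x : {i // c i = k} => ((x.1 : s) : SubHodgeStructure H)).toSubmodule := by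
    rw [(isInternal_iSup'_fiber (fun S : s => (S : SubHodgeStructure H)) hT c).submodule_iSup_eq_top]
    exact Submodule.mem_top
  refine Submodule.iSup_induction _
    (motive := fun w => ((γ : V ≃ₗ[ℚ] V) : Module.End ℚ V) w = ((γ' : V ≃ₗ[ℚ] V) : Module.End ℚ V) w) hv
    (fun k w hw => ?_) (by rw [map_zero, map_zero]) fun w w' hw hw' => by rw [map_add, map_add, hw, hw']
  obtain ⟨ε, hε, hε'⟩ := h _ (minimal_stable_iSup'_fiber (fun S : s => (S : SubHodgeStructure H)) hT hc hκ hirr' k)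
  rw [LinearEquiv.coe_coe, LinearEquiv.coe_coe, hε w hw, hε' w hw]

/-- **EVERY SIGN VECTOR IS REALISED BY EXACTLY ONE CENTRAL ELEMENT** (`†` of the first kind): for every choice of signs
`σ_S = ±1` on the canonical blocks (read off any `σ : SubHodgeStructure H → ℤˣ`; only its values on the canonical blocks
matter) there is a unique central `γ ∈ S(H)(ℚ)` with `γ|_S = σ_S` for every canonical block `S` — the tuple `(σ_S) ∈ Π_k K_k
= C₀` is a `†`-fixed central unit `z` with `z† z = z² = 1`, hence `↑γ` for a central `γ` (g54-#8
`Polarization.exists_mem_center_lefschetzGroup_coe_eq`); uniqueness by `eq_of_forall_exists_forall_apply_eq_smul`.  This is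
«`S₀(A)(ℚ) = {±1}^t`» element by element. [cite: Milne1999LefschetzClasses, §1 p. 645 L1–L14 (S₀, Prop. 1.7) and §2 Summary p. 652]
[cite: MoonenZarhin1998WeilClasses, §1 Lemma (1)] [cite: Lange2023AbelianVarietiesComplex, §2.4.4 Cor. 2.4.26 and §2.6.2 Lemma 2.6.4] -/
theorem Polarization.existsUnique_mem_center_lefschetzGroup_forall_apply_eq_smul (ψ : Polarization H)
    (hfix : ∀ z : H.endAlg, z ∈ Subalgebra.center ℚ H.endAlg → ψ.adjoint (z : Module.End ℚ V) = z)
    (σ : SubHodgeStructure H → ℤˣ) :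
    ∃! γ : ψ.lefschetzGroup, γ ∈ Subgroup.center ψ.lefschetzGroup ∧
      ∀ S : SubHodgeStructure H, ((∀ a ∈ H.endAlg, ∀ v ∈ S.toSubmodule, a v ∈ S.toSubmodule) ∧ S.toSubmodule ≠ ⊥ ∧
        ∀ S' : SubHodgeStructure H, (∀ a ∈ H.endAlg, ∀ v ∈ S'.toSubmodule, a v ∈ S'.toSubmodule) →
          S'.toSubmodule ≤ S.toSubmodule → S'.toSubmodule = ⊥ ∨ S'.toSubmodule = S.toSubmodule) →
        ∀ v ∈ S.toSubmodule, (γ : V ≃ₗ[ℚ] V) v = (σ S : ℤ) • v := by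
  classical
  obtain ⟨s, _, κ, c, hT, hirr, hc, hκ⟩ := exists_isInternal_isIrreducible_labelling H ⟨ψ⟩
  have hirr' : ∀ x : s, (x : SubHodgeStructure H).toHodgeStructure.IsIrreducible := fun x => hirr x x.2
  obtain ⟨e, he⟩ := exists_algEquiv_pi_endAlg_iSup'_fiber (fun S : s => (S : SubHodgeStructure H)) hT hc hκ hirr'
  obtain ⟨ζ, hζ⟩ := exists_ringEquiv_subringCenter_pi
    (fun k : κ => SubHodgeStructure.iSup' fun x : {i // c i = k} => ((x.1 : s) : SubHodgeStructure H)) e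
  -- the central unit `w` whose chart is the prescribed sign vector on the blocks `W_k`
  obtain ⟨w, hww, hw⟩ := exists_mul_self_eq_one_forall_apply_eq₅₅
    (R := fun k : κ => Subring.center
      (SubHodgeStructure.iSup' fun x : {i // c i = k} => ((x.1 : s) : SubHodgeStructure H)).toHodgeStructure.endAlg)
    ζ fun k => σ (SubHodgeStructure.iSup' fun x : {i // c i = k} => ((x.1 : s) : SubHodgeStructure H))
  have hwc : (w : H.endAlg) ∈ Subalgebra.center ℚ H.endAlg :=
    Subalgebra.mem_center_iff.2 (Subring.mem_center_iff.1 w.2)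
  have hunit : ψ.adjoint ((w : H.endAlg) : Module.End ℚ V) * ((w : H.endAlg) : Module.End ℚ V) = 1 := by
    rw [hfix _ hwc, ← Subalgebra.coe_mul, ← Subring.coe_mul, hww, OneMemClass.coe_one, OneMemClass.coe_one]
  obtain ⟨γ, hγ, hγw⟩ := ψ.exists_mem_center_lefschetzGroup_coe_eq hwc hunit
  -- `γ` acts on `W_k` as the prescribed sign
  have hγk : ∀ (k : κ) (v : V),
      v ∈ (SubHodgeStructure.iSup' fun x : {i // c i = k} => ((x.1 : s) : SubHodgeStructure H)).toSubmodule →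
        (γ : V ≃ₗ[ℚ] V) v =
          (σ (SubHodgeStructure.iSup' fun x : {i // c i = k} => ((x.1 : s) : SubHodgeStructure H)) : ℤ) • v := by
    intro k v hv
    have h1 := he (w : H.endAlg) k ⟨v, hv⟩
    rw [Submodule.coe_mk] at h1
    rw [← LinearEquiv.coe_coe, hγw, ← h1, ← hζ w k, hw k]
    exact coe_intCast_subringCenter_apply₅₅ _ _ v hv
  refine ⟨γ, ⟨hγ, fun S hS v hv => ?_⟩, ?_⟩
  · -- every canonical block is a `W_k`
    obtain ⟨k, hk, -⟩ :=
      existsUnique_iSup'_fiber_eq_of_minimal_stable (fun S : s => (S : SubHodgeStructure H)) hT hc hκ hirr' hS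
    subst hk
    exact hγk k v hv
  · rintro γ' ⟨-, hγ'σ⟩
    refine ψ.eq_of_forall_exists_forall_apply_eq_smul fun S hS => ⟨σ S, hγ'σ S hS, fun v hv => ?_⟩
    obtain ⟨k, hk, -⟩ :=
      existsUnique_iSup'_fiber_eq_of_minimal_stable (fun S : s => (S : SubHodgeStructure H)) hT hc hκ hirr' hS
    subst hk
    exact hγk k v hv

/-- **`Z(S(H)(ℚ)) ≅ μ₂^t` CANONICALLY: THE SIGN CHARACTERS FORM A GROUP ISOMORPHISM** (`†` of the first kind, types I–III):
there is a group isomorphism `e : Z(S(H)(ℚ)) ≃* ({canonical blocks of H} → ℤˣ)` such that every central `γ` acts on every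
canonical block `S` as the sign `e γ S`: `γ v = (e γ S) • v` for `v ∈ S`.  (Well defined by §1; multiplicative because the
signs multiply on each non-zero block; injective by `eq_of_forall_exists_forall_apply_eq_smul`; surjective by
`existsUnique_mem_center_lefschetzGroup_forall_apply_eq_smul`.)  Milne's «`S₀(A) ≅` the centre of `S(A)`» with
`S₀(ℚ) = U_{C₀}(ℚ) = {±1}^t` for `†` trivial on `C₀ = K₁ × ⋯ × K_t`, TOGETHER WITH ITS ACTION ON `V`; Moonen–Zarhin's «in all
other cases it is finite». [cite: Milne1999LefschetzClasses, §1 p. 645 L1–L14 (S₀, Prop. 1.7) and §2 Summary p. 652]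
[cite: MoonenZarhin1998WeilClasses, §1 Lemma (1)] [cite: Lange2023AbelianVarietiesComplex, §2.4.4 Cor. 2.4.26 and §2.6.2 Lemma 2.6.4] -/
theorem Polarization.exists_mulEquiv_center_lefschetzGroup_pi_units (ψ : Polarization H)
    (hfix : ∀ z : H.endAlg, z ∈ Subalgebra.center ℚ H.endAlg → ψ.adjoint (z : Module.End ℚ V) = z) :
    ∃ e : Subgroup.center ψ.lefschetzGroup ≃*
      ({S : SubHodgeStructure H // (∀ a ∈ H.endAlg, ∀ v ∈ S.toSubmodule, a v ∈ S.toSubmodule) ∧ S.toSubmodule ≠ ⊥ ∧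
        ∀ S' : SubHodgeStructure H, (∀ a ∈ H.endAlg, ∀ v ∈ S'.toSubmodule, a v ∈ S'.toSubmodule) →
          S'.toSubmodule ≤ S.toSubmodule → S'.toSubmodule = ⊥ ∨ S'.toSubmodule = S.toSubmodule} → ℤˣ),
      ∀ (γ : Subgroup.center ψ.lefschetzGroup) (S : {S : SubHodgeStructure H //
        (∀ a ∈ H.endAlg, ∀ v ∈ S.toSubmodule, a v ∈ S.toSubmodule) ∧ S.toSubmodule ≠ ⊥ ∧
        ∀ S' : SubHodgeStructure H, (∀ a ∈ H.endAlg, ∀ v ∈ S'.toSubmodule, a v ∈ S'.toSubmodule) →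
          S'.toSubmodule ≤ S.toSubmodule → S'.toSubmodule = ⊥ ∨ S'.toSubmodule = S.toSubmodule}),
        ∀ v ∈ (S : SubHodgeStructure H).toSubmodule,
          ((γ : ψ.lefschetzGroup) : V ≃ₗ[ℚ] V) v = ((e γ S : ℤˣ) : ℤ) • v := by
  -- the sign of `γ` on `S` (§1), well defined because `S ≠ 0`
  have hex := fun (γ : Subgroup.center ψ.lefschetzGroup) (S : {S : SubHodgeStructure H //
      (∀ a ∈ H.endAlg, ∀ v ∈ S.toSubmodule, a v ∈ S.toSubmodule) ∧ S.toSubmodule ≠ ⊥ ∧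
      ∀ S' : SubHodgeStructure H, (∀ a ∈ H.endAlg, ∀ v ∈ S'.toSubmodule, a v ∈ S'.toSubmodule) →
        S'.toSubmodule ≤ S.toSubmodule → S'.toSubmodule = ⊥ ∨ S'.toSubmodule = S.toSubmodule}) =>
    ψ.exists_forall_apply_eq_smul_of_mem_center_lefschetzGroup hfix γ.2 S.2
  choose ε hε using hex
  -- multiplicative
  have hmul : ∀ γ γ', ε (γ * γ') = ε γ * ε γ' := by
    intro γ γ'
    funext S
    rw [Pi.mul_apply]
    refine units_eq_of_forall_apply_eq_smul_of_ne_bot₅₅ S.2.2.1 (hε (γ * γ') S) fun v hv => ?_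
    have hv' : (ε γ' S : ℤ) • v ∈ (S : SubHodgeStructure H).toSubmodule := Submodule.smul_of_tower_mem _ _ hv
    rw [Subgroup.coe_mul, Subgroup.coe_mul, LinearEquiv.mul_apply, hε γ' S v hv, hε γ S _ hv', smul_smul, Units.val_mul]
  -- injective
  have hinj : Function.Injective ε := by
    intro γ γ' h
    apply Subtype.ext
    exact ψ.eq_of_forall_exists_forall_apply_eq_smul fun S hS => ⟨ε γ ⟨S, hS⟩, hε γ ⟨S, hS⟩, h ▸ hε γ' ⟨S, hS⟩⟩
  -- surjective
  have hsurj : Function.Surjective ε := by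
    classical
    intro τ
    obtain ⟨γ, ⟨hγ, hγσ⟩, -⟩ := ψ.existsUnique_mem_center_lefschetzGroup_forall_apply_eq_smul hfix
      fun S => if hS : _ then τ ⟨S, hS⟩ else 1
    refine ⟨⟨γ, hγ⟩, funext fun S => ?_⟩
    have h := hγσ S.1 S.2
    rw [dif_pos S.2] at h
    exact units_eq_of_forall_apply_eq_smul_of_ne_bot₅₅ S.2.2.1 (hε ⟨γ, hγ⟩ S) h
  exact ⟨MulEquiv.ofBijective (MonoidHom.mk' ε hmul) ⟨hinj, hsurj⟩, fun γ S v hv => hε γ S v hv⟩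

omit [Module.Finite ℚ V] in
/-- **THE SIGN ISOMORPHISM IS UNIQUE**: any two maps `Z(S(H)(ℚ)) → ({canonical blocks} → ℤˣ)` satisfying the formula
`γ v = (e γ S) • v` on each block agree (the sign on a non-zero block is well defined) — so the isomorphism of
`exists_mulEquiv_center_lefschetzGroup_pi_units` is CANONICAL. [cite: Milne1999LefschetzClasses, §1 p. 645 L1–L14 and Prop. 1.5 («independent of the choice»)] -/
theorem Polarization.mulEquiv_center_lefschetzGroup_pi_units_unique (ψ : Polarization H)
    (e e' : Subgroup.center ψ.lefschetzGroup → ({S : SubHodgeStructure H //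
      (∀ a ∈ H.endAlg, ∀ v ∈ S.toSubmodule, a v ∈ S.toSubmodule) ∧ S.toSubmodule ≠ ⊥ ∧
        ∀ S' : SubHodgeStructure H, (∀ a ∈ H.endAlg, ∀ v ∈ S'.toSubmodule, a v ∈ S'.toSubmodule) →
          S'.toSubmodule ≤ S.toSubmodule → S'.toSubmodule = ⊥ ∨ S'.toSubmodule = S.toSubmodule} → ℤˣ))
    (he : ∀ (γ : Subgroup.center ψ.lefschetzGroup) (S : {S : SubHodgeStructure H //
      (∀ a ∈ H.endAlg, ∀ v ∈ S.toSubmodule, a v ∈ S.toSubmodule) ∧ S.toSubmodule ≠ ⊥ ∧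
        ∀ S' : SubHodgeStructure H, (∀ a ∈ H.endAlg, ∀ v ∈ S'.toSubmodule, a v ∈ S'.toSubmodule) →
          S'.toSubmodule ≤ S.toSubmodule → S'.toSubmodule = ⊥ ∨ S'.toSubmodule = S.toSubmodule}),
      ∀ v ∈ (S : SubHodgeStructure H).toSubmodule,
        ((γ : ψ.lefschetzGroup) : V ≃ₗ[ℚ] V) v = ((e γ S : ℤˣ) : ℤ) • v)
    (he' : ∀ (γ : Subgroup.center ψ.lefschetzGroup) (S : {S : SubHodgeStructure H //
      (∀ a ∈ H.endAlg, ∀ v ∈ S.toSubmodule, a v ∈ S.toSubmodule) ∧ S.toSubmodule ≠ ⊥ ∧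
        ∀ S' : SubHodgeStructure H, (∀ a ∈ H.endAlg, ∀ v ∈ S'.toSubmodule, a v ∈ S'.toSubmodule) →
          S'.toSubmodule ≤ S.toSubmodule → S'.toSubmodule = ⊥ ∨ S'.toSubmodule = S.toSubmodule}),
      ∀ v ∈ (S : SubHodgeStructure H).toSubmodule,
        ((γ : ψ.lefschetzGroup) : V ≃ₗ[ℚ] V) v = ((e' γ S : ℤˣ) : ℤ) • v) :
    e = e' :=
  funext fun γ => funext fun S => units_eq_of_forall_apply_eq_smul_of_ne_bot₅₅ S.2.2.1 (he γ S) (he' γ S)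

/-- **ALL SIGNS `+1` IFF `γ = 1`**: a central `γ ∈ S(H)(ℚ)` (`†` of the first kind) fixing every canonical block pointwise is the
identity (the blocks span `V`). [cite: Milne1999LefschetzClasses, §1 p. 645 L1–L6] [cite: Lange2023AbelianVarietiesComplex, §2.4.4 Cor. 2.4.26] -/
theorem Polarization.eq_one_of_forall_apply_eq_self (ψ : Polarization H) {γ : ψ.lefschetzGroup}
    (h : ∀ S : SubHodgeStructure H, ((∀ a ∈ H.endAlg, ∀ v ∈ S.toSubmodule, a v ∈ S.toSubmodule) ∧ S.toSubmodule ≠ ⊥ ∧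
      ∀ S' : SubHodgeStructure H, (∀ a ∈ H.endAlg, ∀ v ∈ S'.toSubmodule, a v ∈ S'.toSubmodule) →
        S'.toSubmodule ≤ S.toSubmodule → S'.toSubmodule = ⊥ ∨ S'.toSubmodule = S.toSubmodule) →
      ∀ v ∈ S.toSubmodule, (γ : V ≃ₗ[ℚ] V) v = v) :
    γ = 1 :=
  ψ.eq_of_forall_exists_forall_apply_eq_smul fun S hS =>
    ⟨1, fun v hv => by rw [h S hS v hv, Units.val_one, one_zsmul], fun v _ => by
      rw [Units.val_one, one_zsmul]; rfl⟩

end HodgeStructure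

end Literature.AlgebraicGeometry.Motives
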